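import Summits.QuantumFields.BalabanUV.T4Continuum.Support.NE2FromNE3BavgBridge

/-!
# RegularTowerSubdivision — the `R`-adic BOX-SPLINE SUBDIVISION of a site family on a block-refined torus:
# size is preserved, first differences contract by EXACTLY `1∕R`, and the refined family stays within `2d` Lipschitz units of its parent

Cell `pub-balaban`, unit `b2b-balaban-t4-ne5-p1` (row NE5 OWNER, gen 41; owner item «S1» of RULING R63, `HOME/CLAIMS.log`
«RULING R63», 2026-08-21).  Summits-side NEW WORK under the LEAN PLACEMENT RULE ([folklore] lattice bookkeeping on OUR typed objects; 0 `def … : Prop`;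
nothing printed is asserted; no citation tags).

WHY (R63 = the answer to T4-DAG §8 Q50 (b)).  The un-windowed two-level binder `hloc : LocalRate (bgReadings (regClass (liftR (RgV V)))) C θ` of the
W1 rate road (g38-c `B13ReadingsRecordRate`, W-21c, the seven rate-road ENDs) cannot be inhabited at a `towerOf`-PADDED finite averaging tower (registry fact
F-TOP: the junk level `K+1` reads `1`, so the clause `k = K` compares the finest connection with `0`).  Instead of threading a window through row NE2's whole
chain (disposition (R1)), the owner EXTENDS the finite tower above its top by SUBDIVISION of the finest connection: this file is the one-step operator and its
first two facts (size, first differences); `RegularTowerSubdivisionParent` adds parent consistency, `RegularTowerSubdivisionSecond` (S2) the second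
differences, `RegularTowerPadding` (S3) the padded tower and its letters.

WHAT ([folklore]; generic normed `ℂ`-space `E`; the `Fin d` label of `Tor (fine N M) × Fin d` is passive, so the operator acts on every component
field `R k ν : idx L M k → M_o(ℂ)` of a transporter tower).
 * §1 `pullback` (`w ∘ parT`), `boxSum`∕`boxAvg` (the `R^d`-point box with corner `x`: `R^{−d} Σ_j v (x + off j)`), `hatAvg μ` (the same box with the
   `μ`-offset forced to `0`), **`subdiv := boxAvg ∘ boxAvg ∘ pullback`** (the `R`-adic subdivision mask `Π_ν (Σ_{i<R} z_ν^i)²∕R² ∘ upsampling` = the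
   degree-one box spline refined twice; two boxes are what S2 needs for the pure second differences); translation lemmas; `boxAvg_const`;
   size: `norm_boxAvg_le`, `norm_hatAvg_le`, **`norm_subdiv_le`** (an average of values of `w`).
 * §2 THE TELESCOPING IDENTITY **`boxAvg_tau_sub`**: `boxAvg v (τ_μ x) − boxAvg v x = R⁻¹ • hatAvg μ (v(· + R e_μ) − v) x` (the `μ`-line of the box telescopes:
   `(1 − z_μ)·Σ_{i<R} z_μ^i = 1 − z_μ^R`), the parent of an `R`-step `par_add_tstep_self` (`par (x + R e_μ) = par x + e_μ`), hence
   **`subdiv_tau_sub`**: `subdiv w (τ_μ x) − subdiv w x = R⁻¹ • hatAvg μ (boxAvg (pullback (w ∘ τ_μ − w))) x` and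
   **`norm_subdiv_tau_sub_le`**: `(∀ i, ‖w (τ_μ i) − w i‖ ≤ b) → ‖subdiv w (τ_μ x) − subdiv w x‖ ≤ b ∕ R` — the lattice-Lipschitz letter `β∕L^k` of
   `RegularTransporters` propagates to the refined level with the SAME `β`.
 * Parent consistency (`‖subdiv w x − w (parT x)‖ ≤ 2d·b`) is the sibling `RegularTowerSubdivisionParent`; second differences are S2.
HONEST FRAMING: rung (B)+1 bookkeeping of the FINITE-VOLUME T⁴ programme — NOT infinite volume, NOT a mass gap, NOT Clay; NE5 ∕ NE2 NOT PRINTED ∕ NOT PROVED;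
spine 0∕9; nothing of [Balaban1985Averaging] ∕ [Balaban1985BackgroundPropagators] is asserted or instantiated.  HONEST DEPENDENCY (cell line, verbatim):
continuum YM on T⁴ ⇐ BetaPertH ∧ nine spine estimates (0/9 proved); BetaPertH ⇐ (D1) ∧ (D4) ∧ CAP+tail; G-an2-4 gates asym, D1 and NE2/3/4.
0 sorry; axioms ⊆ {propext, Classical.choice, Quot.sound}.
-/

noncomputable section

open scoped BigOperators Matrix Matrix.Norms.L2Operator

namespace Summit.QuantumFields.BalabanUV.T4Continuum.RegularTowerSubdivision

open Literature.MathematicalPhysics.QuantumFieldTheory.Balaban1983to89.B5Prop11Plancherel (fine Tor unitVec)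
open Literature.MathematicalPhysics.QuantumFieldTheory.Balaban1983to89.B5Block118 (tstep tstep_zero tstep_succ)
open Literature.MathematicalPhysics.QuantumFieldTheory.Balaban1983to89.B5G183RateTorus (cpt)
open Literature.MathematicalPhysics.QuantumFieldTheory.Balaban1983to89.B5G183RateTorusW (off)
open Summit.QuantumFields.BalabanUV.T4Continuum
open Summit.QuantumFields.BalabanUV.T4Continuum.BalabanAveragedTowerModes (par rem val_par par_cpt_add_off cpt_par_add_off_rem)
open Summit.QuantumFields.BalabanUV.T4Continuum.BlockPairingGeometry (tau parT par_add_unitVec)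
open Summit.QuantumFields.BalabanUV.T4Continuum.BalabanBlockPoincare (off_eq_sum_tstep)
open Summit.QuantumFields.BalabanUV.T4Continuum.CovariantLinePlanting (par_add_tstep)
open Summit.QuantumFields.BalabanUV.T4Continuum.NE2FromNE3BavgBridge (norm_sub_tstep_le)

variable {d : ℕ}

/-! ## §1 The operators -/

section Ops

variable (N R : ℕ) [NeZero N] [NeZero R] (M : Fin d → ℕ) [hM : ∀ μ, NeZero (M μ)]
variable {E : Type*} [NormedAddCommGroup E] [NormedSpace ℂ E]

/-- PULLBACK along the block parent: `(pullback w)(x′) = w (parT x′)` (piecewise constant on blocks). [folklore] -/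
def pullback (w : Tor (fine N M) × Fin d → E) (x : Tor (fine (R * N) M) × Fin d) : E := w (parT N R M x)

/-- the BOX SUM over the `R^d` fine sites `x + off j`, `j ∈ [0, R)^d` (corner `x`; the `Fin d` label is passive). [folklore] -/
def boxSum (v : Tor (fine (R * N) M) × Fin d → E) (x : Tor (fine (R * N) M) × Fin d) : E :=
  ∑ j : Fin d → Fin R, v (x.1 + off N R M j, x.2)

/-- the BOX AVERAGE `R^{−d}·boxSum`. [folklore] -/
def boxAvg (v : Tor (fine (R * N) M) × Fin d → E) (x : Tor (fine (R * N) M) × Fin d) : E :=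
  ((R : ℂ) ^ d)⁻¹ • boxSum N R M v x

/-- the HAT AVERAGE in direction `μ`: the box average with the `μ`-offset forced to `0` (each of the `R^{d−1}` restricted offsets counted `R` times,
total weight `1`). [folklore] -/
def hatAvg (μ : Fin d) (u : Tor (fine (R * N) M) × Fin d → E) (x : Tor (fine (R * N) M) × Fin d) : E :=
  ((R : ℂ) ^ d)⁻¹ • ∑ j : Fin d → Fin R, u (x.1 + off N R M (Function.update j μ 0), x.2)

/-- **THE SUBDIVISION** `subdiv = boxAvg ∘ boxAvg ∘ pullback`: the coarse family pulled back to the fine lattice and box-averaged twice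
(per direction the mask `(Σ_{i<R} z^i)²∕R²` on the upsampled data — the `R`-adic refinement of the degree-one box spline). [folklore] -/
def subdiv (w : Tor (fine N M) × Fin d → E) : Tor (fine (R * N) M) × Fin d → E :=
  boxAvg N R M (boxAvg N R M (pullback N R M w))

variable {N R M}

omit [NeZero N] [NeZero R] hM in
/-- unfolding `boxAvg`. [folklore] -/
theorem boxAvg_apply (v : Tor (fine (R * N) M) × Fin d → E) (x : Tor (fine (R * N) M) × Fin d) :
    boxAvg N R M v x = ((R : ℂ) ^ d)⁻¹ • ∑ j : Fin d → Fin R, v (x.1 + off N R M j, x.2) := rfl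

omit [NeZero N] [NeZero R] hM [NormedSpace ℂ E] in
/-- the box sum commutes with translations of the corner. [folklore] -/
theorem boxSum_translate (v : Tor (fine (R * N) M) × Fin d → E) (t : Tor (fine (R * N) M)) (x : Tor (fine (R * N) M) × Fin d) :
    boxSum N R M v (x.1 + t, x.2) = boxSum N R M (fun y => v (y.1 + t, y.2)) x := by
  unfold boxSum
  refine Finset.sum_congr rfl fun j _ => ?_
  rw [add_right_comm]

omit [NeZero N] [NeZero R] hM in
/-- the box average commutes with translations of the corner. [folklore] -/
theorem boxAvg_translate (v : Tor (fine (R * N) M) × Fin d → E) (t : Tor (fine (R * N) M)) (x : Tor (fine (R * N) M) × Fin d) :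
    boxAvg N R M v (x.1 + t, x.2) = boxAvg N R M (fun y => v (y.1 + t, y.2)) x := by
  unfold boxAvg; rw [boxSum_translate]

omit [NeZero N] hM in
/-- . [folklore] -/
theorem hatAvg_translate (μ : Fin d) (u : Tor (fine (R * N) M) × Fin d → E) (t : Tor (fine (R * N) M)) (x : Tor (fine (R * N) M) × Fin d) :
    hatAvg N R M μ u (x.1 + t, x.2) = hatAvg N R M μ (fun y => u (y.1 + t, y.2)) x := by
  unfold hatAvg
  congr 1
  refine Finset.sum_congr rfl fun j _ => ?_
  rw [add_right_comm]

omit [NeZero N] [NeZero R] hM in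
/-- `boxAvg` at `τ_μ x` is `boxAvg` of the translate. [folklore] -/
theorem boxAvg_tau (v : Tor (fine (R * N) M) × Fin d → E) (μ : Fin d) (x : Tor (fine (R * N) M) × Fin d) :
    boxAvg N R M v (tau (fine (R * N) M) μ x) = boxAvg N R M (fun y => v (tau (fine (R * N) M) μ y)) x :=
  boxAvg_translate v (unitVec (fine (R * N) M) μ) x

omit [NeZero N] hM in
/-- `hatAvg` at `τ_ν x` is `hatAvg` of the translate. [folklore] -/
theorem hatAvg_tau (μ : Fin d) (u : Tor (fine (R * N) M) × Fin d → E) (ν : Fin d) (x : Tor (fine (R * N) M) × Fin d) :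
    hatAvg N R M μ u (tau (fine (R * N) M) ν x) = hatAvg N R M μ (fun y => u (tau (fine (R * N) M) ν y)) x :=
  hatAvg_translate μ u (unitVec (fine (R * N) M) ν) x

omit [NeZero N] [NeZero R] hM in
/-- linearity of `boxAvg` in the family: differences. [folklore] -/
theorem boxAvg_sub (v v' : Tor (fine (R * N) M) × Fin d → E) (x : Tor (fine (R * N) M) × Fin d) :
    boxAvg N R M v x - boxAvg N R M v' x = boxAvg N R M (fun y => v y - v' y) x := by
  simp only [boxAvg_apply, ← smul_sub, ← Finset.sum_sub_distrib]

omit [NeZero N] hM in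
/-- linearity of `hatAvg` in the family: differences. [folklore] -/
theorem hatAvg_sub (μ : Fin d) (u u' : Tor (fine (R * N) M) × Fin d → E) (x : Tor (fine (R * N) M) × Fin d) :
    hatAvg N R M μ u x - hatAvg N R M μ u' x = hatAvg N R M μ (fun y => u y - u' y) x := by
  simp only [hatAvg, ← smul_sub, ← Finset.sum_sub_distrib]

omit [NeZero N] [NeZero R] hM in
/-- linearity of `boxAvg` in the family: complex scalars. [folklore] -/
theorem boxAvg_smul (c : ℂ) (v : Tor (fine (R * N) M) × Fin d → E) (x : Tor (fine (R * N) M) × Fin d) :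
    boxAvg N R M (fun y => c • v y) x = c • boxAvg N R M v x := by
  simp only [boxAvg_apply, ← Finset.smul_sum, smul_comm c]

omit [NeZero N] hM in
/-- linearity of `hatAvg` in the family: complex scalars. [folklore] -/
theorem hatAvg_smul (μ : Fin d) (c : ℂ) (u : Tor (fine (R * N) M) × Fin d → E) (x : Tor (fine (R * N) M) × Fin d) :
    hatAvg N R M μ (fun y => c • u y) x = c • hatAvg N R M μ u x := by
  simp only [hatAvg, ← Finset.smul_sum, smul_comm c]

omit [NeZero N] hM in
/-- the number of box offsets is `R^d`, as a complex normalisation: `R^{−d}·Σ_j c = c`. [folklore] -/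
theorem invRd_smul_sum_const (c : E) : ((R : ℂ) ^ d)⁻¹ • ∑ _j : Fin d → Fin R, c = c := by
  have hRd : ((R : ℂ) ^ d) ≠ 0 := pow_ne_zero _ (by exact_mod_cast NeZero.ne R)
  have hcard : (Finset.univ : Finset (Fin d → Fin R)).card = R ^ d := by
    rw [Finset.card_univ, Fintype.card_fun, Fintype.card_fin, Fintype.card_fin]
  rw [Finset.sum_const, hcard, ← Nat.cast_smul_eq_nsmul ℂ, smul_smul, Nat.cast_pow, inv_mul_cancel₀ hRd, one_smul]

omit [NeZero N] hM in
/-- the box average of a constant family is the constant. [folklore] -/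
theorem boxAvg_const (c : E) (x : Tor (fine (R * N) M) × Fin d) : boxAvg N R M (fun _ => c) x = c :=
  invRd_smul_sum_const c

omit [NeZero N] hM in
/-- the hat average of a constant family is the constant. [folklore] -/
theorem hatAvg_const (μ : Fin d) (c : E) (x : Tor (fine (R * N) M) × Fin d) : hatAvg N R M μ (fun _ => c) x = c :=
  invRd_smul_sum_const c

omit [NeZero N] hM in
/-- **AN `R^{−d}`-WEIGHTED SUM OF `R^d` VECTORS OF NORM `≤ b` HAS NORM `≤ b`.** [folklore] -/
theorem norm_invRd_smul_sum_le {f : (Fin d → Fin R) → E} {b : ℝ} (hf : ∀ j, ‖f j‖ ≤ b) :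
    ‖((R : ℂ) ^ d)⁻¹ • ∑ j : Fin d → Fin R, f j‖ ≤ b := by
  have hR : (0 : ℝ) < R := by exact_mod_cast Nat.pos_of_ne_zero (NeZero.ne R)
  have hcard : (Finset.univ : Finset (Fin d → Fin R)).card = R ^ d := by
    rw [Finset.card_univ, Fintype.card_fun, Fintype.card_fin, Fintype.card_fin]
  rw [norm_smul, norm_inv, norm_pow, Complex.norm_natCast]
  calc ((R : ℝ) ^ d)⁻¹ * ‖∑ j : Fin d → Fin R, f j‖
      ≤ ((R : ℝ) ^ d)⁻¹ * ∑ j : Fin d → Fin R, ‖f j‖ := mul_le_mul_of_nonneg_left (norm_sum_le _ _) (by positivity)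
    _ ≤ ((R : ℝ) ^ d)⁻¹ * ∑ _j : Fin d → Fin R, b := mul_le_mul_of_nonneg_left (Finset.sum_le_sum fun j _ => hf j) (by positivity)
    _ = b := by
        rw [Finset.sum_const, hcard, nsmul_eq_mul, Nat.cast_pow, ← mul_assoc, inv_mul_cancel₀ (pow_ne_zero _ hR.ne'), one_mul]

omit [NeZero N] hM in
/-- size of a box average: pointwise bounds pass through. [folklore] -/
theorem norm_boxAvg_le {v : Tor (fine (R * N) M) × Fin d → E} {b : ℝ} (hv : ∀ y, ‖v y‖ ≤ b) (x : Tor (fine (R * N) M) × Fin d) :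
    ‖boxAvg N R M v x‖ ≤ b :=
  norm_invRd_smul_sum_le fun _ => hv _

omit [NeZero N] hM in
/-- size of a hat average: pointwise bounds pass through. [folklore] -/
theorem norm_hatAvg_le (μ : Fin d) {u : Tor (fine (R * N) M) × Fin d → E} {b : ℝ} (hu : ∀ y, ‖u y‖ ≤ b) (x : Tor (fine (R * N) M) × Fin d) :
    ‖hatAvg N R M μ u x‖ ≤ b :=
  norm_invRd_smul_sum_le fun _ => hu _

omit [NeZero N] [NeZero R] hM [NormedSpace ℂ E] in
/-- size of a pullback: pointwise bounds pass through. [folklore] -/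
theorem norm_pullback_le {w : Tor (fine N M) × Fin d → E} {b : ℝ} (hw : ∀ i, ‖w i‖ ≤ b) (x : Tor (fine (R * N) M) × Fin d) :
    ‖pullback N R M w x‖ ≤ b :=
  hw _

omit [NeZero N] hM in
/-- **THE SIZE LETTER IS PRESERVED**: `(∀ i, ‖w i‖ ≤ b) → ‖subdiv w x‖ ≤ b` (the subdivision is an average of values of `w`). [folklore] -/
theorem norm_subdiv_le {w : Tor (fine N M) × Fin d → E} {b : ℝ} (hw : ∀ i, ‖w i‖ ≤ b) (x : Tor (fine (R * N) M) × Fin d) :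
    ‖subdiv N R M w x‖ ≤ b :=
  norm_boxAvg_le (fun y => norm_boxAvg_le (fun z => norm_pullback_le hw z) y) x

end Ops

/-! ## §2 The telescoping identity and the `1∕R`-contraction of first differences -/

section Telescope

variable (N R : ℕ) [NeZero N] [NeZero R] (M : Fin d → ℕ) [hM : ∀ μ, NeZero (M μ)]
variable {E : Type*} [NormedAddCommGroup E] [NormedSpace ℂ E]

omit [NeZero N] hM in
/-- the offset with the `μ`-slot set to `a` is the offset with the `μ`-slot `0` plus `a` own-direction steps. [folklore] -/
theorem off_update (j : Fin d → Fin R) (μ : Fin d) (a : Fin R) :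
    off N R M (Function.update j μ a) = off N R M (Function.update j μ 0) + tstep (fine (R * N) M) μ (a : ℕ) := by
  funext ν
  simp only [off, tstep, Pi.add_apply]
  by_cases h : ν = μ
  · subst h; simp
  · simp [h]

omit [NeZero N] [NeZero R] hM [NormedSpace ℂ E] in
/-- re-indexing a sum over all offsets by the `μ`-slot and the rest: `Σ_j F j = Σ_j R⁻¹·Σ_a F (update j μ a)` in the form
`Σ_j F j = Σ_{(a, r)} F (fill a r)` via `Equiv.piSplitAt`. [folklore] -/
theorem sum_offsets_split (μ : Fin d) (F : (Fin d → Fin R) → E) :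
    ∑ j : Fin d → Fin R, F j
      = ∑ r : {ν // ν ≠ μ} → Fin R, ∑ a : Fin R, F ((Equiv.piSplitAt μ (fun _ => Fin R)).symm (a, r)) := by
  rw [← (Equiv.piSplitAt μ (fun _ : Fin d => Fin R)).symm.sum_comp, Fintype.sum_prod_type, Finset.sum_comm]

omit [NeZero N] hM in
/-- the split index with `μ`-slot `a` is the `update` at `μ` of the split index with slot `0`. [folklore] -/
theorem piSplitAt_symm_eq_update (μ : Fin d) (a : Fin R) (r : {ν // ν ≠ μ} → Fin R) :
    (Equiv.piSplitAt μ (fun _ => Fin R)).symm (a, r)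
      = Function.update ((Equiv.piSplitAt μ (fun _ => Fin R)).symm (0, r)) μ a := by
  funext ν
  by_cases h : ν = μ
  · subst h; simp [Equiv.piSplitAt]
  · simp [Equiv.piSplitAt, h]

omit [NeZero N] hM [NormedSpace ℂ E] in
/-- summing `G (update j μ 0)` over all offsets `j` does not see the `μ`-slot: `Σ_j G (update j μ 0) = Σ_r Σ_a G (fill 0 r)`. [folklore] -/
theorem sum_update_zero_split (μ : Fin d) (G : (Fin d → Fin R) → E) :
    ∑ j : Fin d → Fin R, G (Function.update j μ 0)
      = ∑ r : {ν // ν ≠ μ} → Fin R, ∑ _a : Fin R, G ((Equiv.piSplitAt μ (fun _ => Fin R)).symm (0, r)) := by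
  rw [sum_offsets_split R μ (fun j => G (Function.update j μ 0))]
  refine Finset.sum_congr rfl fun r _ => Finset.sum_congr rfl fun a _ => ?_
  show G (Function.update ((Equiv.piSplitAt μ (fun _ => Fin R)).symm (a, r)) μ 0) = _
  rw [piSplitAt_symm_eq_update R μ a r, Function.update_idem, ← piSplitAt_symm_eq_update R μ 0 r]

omit [NeZero N] [NeZero R] hM [NormedSpace ℂ E] in
/-- telescoping over the `μ`-slot: `Σ_{a<R} (f (a+1) − f a) = f R − f 0` on `Fin R`. [folklore] -/
theorem sum_fin_telescope (f : ℕ → E) : ∑ a : Fin R, (f ((a : ℕ) + 1) - f a) = f R - f 0 := by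
  rw [Fin.sum_univ_eq_sum_range (fun a => f (a + 1) - f a), Finset.sum_range_sub]

omit [NeZero N] hM in
/-- **THE TELESCOPING IDENTITY**: `boxSum v (τ_μ x) − boxSum v x = Σ_j R⁻¹`-free form
`= Σ_r (v (x + off (fill 0 r) + R e_μ) − v (x + off (fill 0 r)))`, packaged with `hatAvg`:
`boxAvg v (τ_μ x) − boxAvg v x = R⁻¹ • hatAvg μ (y ↦ v (y + R e_μ) − v y) x`. [folklore] -/
theorem boxAvg_tau_sub (v : Tor (fine (R * N) M) × Fin d → E) (μ : Fin d) (x : Tor (fine (R * N) M) × Fin d) :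
    boxAvg N R M v (tau (fine (R * N) M) μ x) - boxAvg N R M v x
      = ((R : ℂ))⁻¹ • hatAvg N R M μ (fun y => v (y.1 + tstep (fine (R * N) M) μ R, y.2) - v y) x := by
  have hR : (R : ℂ) ≠ 0 := by exact_mod_cast NeZero.ne R
  set e := (Equiv.piSplitAt μ (fun _ : Fin d => Fin R)) with he
  -- both box sums re-indexed by (slot, rest)
  have hsum : ∀ t : Tor (fine (R * N) M),
      ∑ j : Fin d → Fin R, v (x.1 + t + off N R M j, x.2)
        = ∑ r : {ν // ν ≠ μ} → Fin R, ∑ a : Fin R,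
            v (x.1 + t + off N R M (e.symm (0, r)) + tstep (fine (R * N) M) μ (a : ℕ), x.2) := by
    intro t
    rw [sum_offsets_split R μ (fun j => v (x.1 + t + off N R M j, x.2))]
    refine Finset.sum_congr rfl fun r _ => Finset.sum_congr rfl fun a _ => ?_
    show v (x.1 + t + off N R M (e.symm (a, r)), x.2) = _
    rw [piSplitAt_symm_eq_update R μ a r, off_update, ← add_assoc]
    congr 3
    rw [piSplitAt_symm_eq_update R μ 0 r, Function.update_idem]
  have h1 : boxSum N R M v (tau (fine (R * N) M) μ x)
      = ∑ r : {ν // ν ≠ μ} → Fin R, ∑ a : Fin R,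
          v (x.1 + off N R M (e.symm (0, r)) + tstep (fine (R * N) M) μ ((a : ℕ) + 1), x.2) := by
    unfold boxSum
    rw [show (tau (fine (R * N) M) μ x).1 = x.1 + unitVec (fine (R * N) M) μ from rfl,
      show (tau (fine (R * N) M) μ x).2 = x.2 from rfl, hsum]
    refine Finset.sum_congr rfl fun r _ => Finset.sum_congr rfl fun a _ => ?_
    rw [tstep_succ]
    congr 2
    abel
  have h0 : boxSum N R M v x
      = ∑ r : {ν // ν ≠ μ} → Fin R, ∑ a : Fin R,
          v (x.1 + off N R M (e.symm (0, r)) + tstep (fine (R * N) M) μ (a : ℕ), x.2) := by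
    unfold boxSum
    have := hsum 0
    rw [add_zero] at this
    exact this
  -- the hat sum, re-indexed the same way
  have hhat : ∑ j : Fin d → Fin R,
      (v (x.1 + off N R M (Function.update j μ 0) + tstep (fine (R * N) M) μ R, x.2) - v (x.1 + off N R M (Function.update j μ 0), x.2))
        = ∑ r : {ν // ν ≠ μ} → Fin R, ∑ _a : Fin R,
            (v (x.1 + off N R M (e.symm (0, r)) + tstep (fine (R * N) M) μ R, x.2) - v (x.1 + off N R M (e.symm (0, r)), x.2)) :=
    sum_update_zero_split R μ
      (fun j => v (x.1 + off N R M j + tstep (fine (R * N) M) μ R, x.2) - v (x.1 + off N R M j, x.2))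
  unfold boxAvg hatAvg
  rw [← smul_sub, h1, h0, ← Finset.sum_sub_distrib, smul_smul]
  simp_rw [← Finset.sum_sub_distrib]
  rw [hhat]
  -- telescoping in each line, then `Σ_a const = R • const`
  have htel : ∀ r : {ν // ν ≠ μ} → Fin R,
      ∑ a : Fin R, (v (x.1 + off N R M (e.symm (0, r)) + tstep (fine (R * N) M) μ ((a : ℕ) + 1), x.2)
          - v (x.1 + off N R M (e.symm (0, r)) + tstep (fine (R * N) M) μ (a : ℕ), x.2))
        = v (x.1 + off N R M (e.symm (0, r)) + tstep (fine (R * N) M) μ R, x.2) - v (x.1 + off N R M (e.symm (0, r)), x.2) := by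
    intro r
    have := sum_fin_telescope (R := R) (fun n => v (x.1 + off N R M (e.symm (0, r)) + tstep (fine (R * N) M) μ n, x.2))
    rw [this, tstep_zero, add_zero]
  simp_rw [htel, Finset.sum_const, Finset.card_univ, Fintype.card_fin, ← Nat.cast_smul_eq_nsmul ℂ, Finset.smul_sum, smul_smul]
  congr 1
  ext1 r
  congr 1
  rw [mul_assoc, mul_comm (((R : ℂ) ^ d)⁻¹) (R : ℂ), ← mul_assoc, inv_mul_cancel₀ hR, one_mul]

/-- **THE PARENT OF AN `R`-STEP**: `par (x + R e_μ) = par x + e_μ` (exactly one block face is crossed). [folklore] -/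
theorem par_add_tstep_self (μ : Fin d) (x : Tor (fine (R * N) M)) :
    par N R M (x + tstep (fine (R * N) M) μ R) = par N R M x + unitVec (fine N M) μ := by
  have hR : 0 < R := Nat.pos_of_ne_zero (NeZero.ne R)
  have hr : (x μ).val % R < R := Nat.mod_lt _ hR
  -- `R` steps = `R − 1` steps, then one more
  have e : tstep (fine (R * N) M) μ R = tstep (fine (R * N) M) μ (R - 1) + unitVec (fine (R * N) M) μ := by
    rw [← tstep_succ, Nat.sub_add_cancel hR]
  rw [e, ← add_assoc, par_add_unitVec, par_add_tstep N R M μ x (by omega : R - 1 < R)]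
  have hmod : ((x + tstep (fine (R * N) M) μ (R - 1)) μ).val % R = ((x μ).val % R + (R - 1)) % R := by
    rw [CovariantLinePlanting.val_add_tstep_mod, Nat.add_mod]
    conv_rhs => rw [Nat.add_mod, Nat.mod_mod]
  have hdiv : (R ∣ ((x + tstep (fine (R * N) M) μ (R - 1)) μ).val + 1) ↔ ((x μ).val % R + (R - 1) + 1) % R = 0 := by
    rw [Nat.dvd_iff_mod_eq_zero, Nat.add_mod, hmod, ← Nat.add_mod]
  set r := (x μ).val % R with hr_def
  by_cases h0 : r = 0
  · -- no face crossed during the first `R − 1` steps; the last step crosses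
    have h1 : (r + (R - 1) + 1) % R = 0 := by rw [h0, zero_add, Nat.sub_add_cancel hR, Nat.mod_self]
    rw [if_pos (hdiv.mpr h1), if_neg (by omega)]
  · -- the face is crossed during the first `R − 1` steps; the last step does not cross
    have h1 : (r + (R - 1) + 1) % R ≠ 0 := by
      rw [show r + (R - 1) + 1 = r + R by omega, Nat.add_mod_right, Nat.mod_eq_of_lt hr]
      exact h0
    rw [if_neg (fun h => h1 (hdiv.mp h)), if_pos (by omega)]

omit [NormedAddCommGroup E] [NormedSpace ℂ E] in
/-- the pullback is `R`-periodic up to the parent's shift: `(pullback w)(x + R e_μ, c) = w (τ_μ (parT (x, c)))`. [folklore] -/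
theorem pullback_add_tstep_self (w : Tor (fine N M) × Fin d → E) (μ : Fin d) (y : Tor (fine (R * N) M) × Fin d) :
    pullback N R M w (y.1 + tstep (fine (R * N) M) μ R, y.2) = w (tau (fine N M) μ (parT N R M y)) := by
  show w (par N R M (y.1 + tstep (fine (R * N) M) μ R), y.2) = w (par N R M y.1 + unitVec (fine N M) μ, y.2)
  rw [par_add_tstep_self]

/-- the `R`-step difference of a box average of the pullback is the box average of the pullback of the COARSE difference. [folklore] -/
theorem boxAvg_pullback_add_tstep_self_sub (w : Tor (fine N M) × Fin d → E) (μ : Fin d) (y : Tor (fine (R * N) M) × Fin d) :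
    boxAvg N R M (pullback N R M w) (y.1 + tstep (fine (R * N) M) μ R, y.2) - boxAvg N R M (pullback N R M w) y
      = boxAvg N R M (pullback N R M (fun i => w (tau (fine N M) μ i) - w i)) y := by
  rw [boxAvg_translate, boxAvg_sub]
  congr 1
  funext z
  rw [pullback_add_tstep_self]
  rfl

/-- **FIRST DIFFERENCES OF THE SUBDIVISION**: `subdiv w (τ_μ x) − subdiv w x = R⁻¹ • hatAvg μ (boxAvg (pullback (w ∘ τ_μ − w))) x` — an
AVERAGE of coarse first differences, times `1∕R`. [folklore] -/
theorem subdiv_tau_sub (w : Tor (fine N M) × Fin d → E) (μ : Fin d) (x : Tor (fine (R * N) M) × Fin d) :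
    subdiv N R M w (tau (fine (R * N) M) μ x) - subdiv N R M w x
      = ((R : ℂ))⁻¹ • hatAvg N R M μ (boxAvg N R M (pullback N R M (fun i => w (tau (fine N M) μ i) - w i))) x := by
  unfold subdiv
  rw [boxAvg_tau_sub]
  congr 1
  congr 1
  funext y
  exact boxAvg_pullback_add_tstep_self_sub N R M w μ y

/-- **THE LIPSCHITZ LETTER CONTRACTS BY EXACTLY `1∕R`**: `(∀ i, ‖w (τ_μ i) − w i‖ ≤ b) → ‖subdiv w (τ_μ x) − subdiv w x‖ ≤ b ∕ R`.
At tower level (`R = L`, `b = β∕L^k`) this is `RegularTransporters.lipschitz` at level `k + 1` with the SAME `β`. [folklore] -/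
theorem norm_subdiv_tau_sub_le {w : Tor (fine N M) × Fin d → E} {μ : Fin d} {b : ℝ} (hw : ∀ i, ‖w (tau (fine N M) μ i) - w i‖ ≤ b)
    (x : Tor (fine (R * N) M) × Fin d) :
    ‖subdiv N R M w (tau (fine (R * N) M) μ x) - subdiv N R M w x‖ ≤ b / R := by
  have hR : (0 : ℝ) < R := by exact_mod_cast Nat.pos_of_ne_zero (NeZero.ne R)
  rw [subdiv_tau_sub, norm_smul, norm_inv, Complex.norm_natCast, div_eq_inv_mul]
  exact mul_le_mul_of_nonneg_left (norm_hatAvg_le μ (fun y => norm_boxAvg_le (fun z => norm_pullback_le hw z) y) x) (inv_nonneg.mpr hR.le)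

end Telescope

end Summit.QuantumFields.BalabanUV.T4Continuum.RegularTowerSubdivision

end
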